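import Literature.AlgebraicGeometry.Frobenioids.ArchimedeanFSMPullback
import Literature.AlgebraicGeometry.Frobenioids.ArchimedeanFSMOverIsoProofs
import Literature.AlgebraicGeometry.Frobenioids.ArchimedeanRealObjectsIso
import Literature.AlgebraicGeometry.Frobenioids.ArchimedeanPseudoTerminal
import HarnessLib

/-!
# Frobenioids II, Proposition 3.4 (vii), the FSMI half: PROOF (abc-iut cell, layer L1,
# node `FrdII:Prop3.4(vii)`, sub-node `FrdII:Prop3.4(vii)/P34-L08`, chain LC-L1-2)

Mochizuki, *The geometry of Frobenioids II: poly-Frobenioids*, Kyushu J. Math. **62** (2008)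
401–460, §3, Proposition 3.4 (vii) p. 30, proof p. 31 ll. 28–44
[cite: MochizukiFrdII2008, Prop 3.4 (vii) p.30].
PROOF-ONLY companion of `ArchimedeanFSM.lean` (statements, seat abc-iut-L1-t6); nothing is defined here.

> "(vii) Let `φ` be a morphism of `F` that projects to a pull-back morphism of `F₀` and to an
> FSM-morphism (respectively, FSMI-morphism) of `D`. Then `φ` is an FSM-morphism (respectively,
> FSMI-morphism) of `F`."  Proof (p. 31): "First, we observe that it follows from assertion (v) that
> it suffices to show that `φ` is an FSM-morphism" — then the FSM argument, which abc-iut-L1-d3 proved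
> (`ArchimedeanFSMPullback.lean`: `A.isFSM_of_pullback`, `N.…`, `R.…`, `prop34_vii_fsm`).

This file supplies the FSMI half and assembles **`prop34_vii_holds : Prop34_vii π`** (item (vii) AS
TYPED for `F = A, N, R`). The typed item (v) is false without the standing hypothesis that `D` be
totally epimorphic (abc-iut-w4-d092, `ArchimedeanFSMIrreducibleCounterexample.lean`), so instead of
invoking (v) we run its second projection pattern directly, where it needs no hypothesis on `D`:
let `φ = (φ₀, φ_D)` with `φ₀` a pull-back morphism of `F₀` and `φ_D` an FSMI-morphism of `D`; `φ` is FSM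
(d3) and not an isomorphism (`φ_D` is not). For a factorization `φ = β ≫ α` in `F`, irreducibility of
`φ_D = β_D ≫ α_D` gives `α_D` or `β_D` invertible, and then the corresponding factor of `φ₀ = β₀ ≫ α₀` is
invertible IN `F₀` — so that the factor of `φ` is invertible (isomorphisms of `F` are detected by the two
projections, w4-d092's `A.isIso_of_isIso_proj` / `N.…` / `R.…`):
* `Base(β₀)` invertible ⇒ `β₀` invertible: the universal property of the pull-back morphism `φ₀`
  ([FrdI] Def. 1.2 (ii)) produces `ζ` with `ζ ≫ φ₀ = α₀`, `Base(ζ) = Base(β₀)⁻¹`, and then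
  `β₀ ≫ ζ = id` by uniqueness; a split monomorphism of the totally epimorphic category `F₀` is an
  isomorphism (`isIso_left_of_pullback_fac`, any pre-Frobenioid on a totally epimorphic category);
* `Base(α₀)` invertible ⇒ `α₀` invertible: if `Base(φ₀)` is invertible then so is `φ₀` ([FrdI]
  Rmk. 1.2.1, `isPullbackMorphism_and_isBaseIso_iff_isIso`) and both factors are; otherwise
  `Base(φ₀) : Spec ℂ → Spec ℝ`, the middle object is real, and an arrow between real objects of `N₀`
  (resp. `R₀`) is an isomorphism (Ex. 3.3 (iv) with the author's Comments (4),
  `N0.isIso_of_isRealObj`); for `A₀` the same holds once `deg_Fr(α₀) = 1`, and `deg_Fr(φ₀) = 1` is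
  forced by the pull-back property of `φ₀` tested against the degree-one isometry
  `X₀ → (unit object over Spec ℝ) → Y₀`.
No statement of the paper is strengthened; no side is taken on [IUTchIII] Cor. 3.12.
-/

namespace Literature.AlgebraicGeometry.Frobenioids

open CategoryTheory

namespace ArchFrd

universe w v v' u u'

/-! ### One more fact about the skeleton `D₀` -/

/-- The source of an isomorphism of `D₀` into `Spec ℝ` is `Spec ℝ`. [cite: MochizukiFrdII2008, §3 p.23] -/
theorem D0.eq_real_of_isIso_of_eq_real {K L : D0} (f : K ⟶ L) (hf : IsIso f) (hL : L = D0.real) :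
    K = D0.real := by
  subst hL
  rcases D0.isReal_or_isComplex K with hK | hK
  · exact hK
  · have hK' : K = D0.complex := hK
    subst hK'
    haveI := hf
    have hm : Mono f := inferInstance
    rw [D0.hom_complex_real_eq f] at hm
    exact absurd hm D0.not_mono_toRealHom

/-! ### Generic: a pull-back morphism splits off no base-isomorphism on the left -/

section PullbackSplit

variable {C : Type u} [Category.{v} C] {B : Type u'} [Category.{v'} B] {Φ : Bᵒᵖ ⥤ CommMonCat.{w}}

/-- For a pre-Frobenioid `C → F_Φ` on a totally epimorphic category: if `φ = β ≫ α` is a pull-back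
morphism and `Base(β)` is an isomorphism, then `β` is an isomorphism. (The universal property of `φ`
gives `ζ` with `ζ ≫ φ = α`, `Base(ζ) = Base(β)⁻¹`; by uniqueness `β ≫ ζ = id`, and a split
monomorphism that is an epimorphism is an isomorphism.) [cite: MochizukiFrdI2008, Def. 1.2(ii)] -/
theorem isIso_left_of_pullback_fac (F : C ⥤ ElemFrobenioid Φ) (hC : IsTotallyEpimorphic C)
    {X M Y : C} {φ : X ⟶ Y} (hφ : PreFrobenioid.IsPullbackMorphism F φ) (β : X ⟶ M) (α : M ⟶ Y)
    (hfac : β ≫ α = φ) (hβ : IsIso (PreFrobenioid.Base F β)) : IsIso β := by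
  haveI := hβ
  have hcond : PreFrobenioid.Base F α = inv (PreFrobenioid.Base F β) ≫ PreFrobenioid.Base F φ := by
    rw [← hfac, PreFrobenioid.base_comp, IsIso.inv_hom_id_assoc]
  obtain ⟨ζ, hζ⟩ := (hφ M).2 ⟨(α, inv (PreFrobenioid.Base F β)), hcond⟩
  have hζ₁ : ζ ≫ φ = α := congrArg (fun p : PreFrobenioid.PullbackHomData F φ M => p.1.1) hζ
  have hζ₂ : PreFrobenioid.Base F ζ = inv (PreFrobenioid.Base F β) :=
    congrArg (fun p : PreFrobenioid.PullbackHomData F φ M => p.1.2) hζ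
  have hβζ : β ≫ ζ = 𝟙 X := by
    apply (hφ X).1
    apply Subtype.ext
    refine Prod.ext ?_ ?_
    · change (β ≫ ζ) ≫ φ = 𝟙 X ≫ φ
      rw [Category.assoc, hζ₁, hfac, Category.id_comp]
    · change PreFrobenioid.Base F (β ≫ ζ) = PreFrobenioid.Base F (𝟙 X)
      rw [PreFrobenioid.base_comp, hζ₂, IsIso.hom_inv_id, PreFrobenioid.base_id]
  haveI : IsSplitMono β := IsSplitMono.mk' ⟨ζ, hβζ⟩
  haveI : Epi β := hC.epi β
  exact isIso_of_epi_of_isSplitMono β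

/-- Same setting: if moreover `Base(φ)` is an isomorphism, then both factors of `φ = β ≫ α` are
isomorphisms (`φ` is one by [FrdI] Rmk. 1.2.1). [cite: MochizukiFrdI2008, Rem. 1.2.1] -/
theorem isIso_and_isIso_of_pullback_fac_of_isIso_base (F : C ⥤ ElemFrobenioid Φ)
    (hC : IsTotallyEpimorphic C) {X M Y : C} {φ : X ⟶ Y} (hφ : PreFrobenioid.IsPullbackMorphism F φ)
    (β : X ⟶ M) (α : M ⟶ Y) (hfac : β ≫ α = φ) (hb : IsIso (PreFrobenioid.Base F φ)) :
    IsIso α ∧ IsIso β := by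
  haveI : IsIso φ := (PreFrobenioid.isPullbackMorphism_and_isBaseIso_iff_isIso F φ).mp ⟨hφ, hb⟩
  haveI : IsIso (β ≫ α) := by rw [hfac]; infer_instance
  exact hC.isIso_of_isIso_comp β α

end PullbackSplit

/-! ### Generic: the FSMI half of (vii) for a tower -/

namespace Tower

variable {D : Type u} [Category.{v} D] {π : D ⥤ D0} (T : Tower π)

/-- **Prop. 3.4 (vii), FSMI half, generic form** (the second projection pattern of (v), run without any
hypothesis on `D`): for a tower in which (a) isomorphisms of `F` are detected by the two projections,
(b) an arrow over an isomorphism of `D` has `F₀`-projection over an isomorphism of `D₀`, and (c) for a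
pull-back morphism `φ₀ = β₀ ≫ α₀` of `F₀` a factor lying over an isomorphism of `D₀` is an isomorphism —
an FSM-morphism `φ` of `F` projecting to a pull-back morphism of `F₀` and to an FSMI-morphism of `D` is
an FSMI-morphism. [cite: MochizukiFrdII2008, Prop 3.4 (vii) p.31] -/
theorem isFSMI_of_pullback
    (hrefl : ∀ ⦃X Y : T.F⦄ (φ : X ⟶ Y), IsIso (T.toD.map φ) → IsIso (T.toF0.map φ) → IsIso φ)
    (hbase : ∀ ⦃X Y : T.F⦄ (φ : X ⟶ Y), IsIso (T.toD.map φ) → IsIso (T.base0.map (T.toF0.map φ)))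
    (hF0 : ∀ ⦃X₀ M₀ Y₀ : T.F0⦄ (φ₀ : X₀ ⟶ Y₀), PreFrobenioid.IsPullbackMorphism T.str0 φ₀ →
      ∀ (β₀ : X₀ ⟶ M₀) (α₀ : M₀ ⟶ Y₀), β₀ ≫ α₀ = φ₀ →
        (IsIso (T.base0.map β₀) → IsIso β₀) ∧ (IsIso (T.base0.map α₀) → IsIso α₀))
    {X Y : T.F} (φ : X ⟶ Y) (hpb : PreFrobenioid.IsPullbackMorphism T.str0 (T.toF0.map φ))
    (hFSM : IsFSM φ) (hD : IsFSMI (T.toD.map φ)) : IsFSMI φ := by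
  refine ⟨hFSM, fun hiso => ?_, fun M β α hfac => ?_⟩
  · haveI := hiso
    exact hD.2.1 (inferInstance : IsIso (T.toD.map φ))
  · have hfac0 : T.toF0.map β ≫ T.toF0.map α = T.toF0.map φ := by rw [← Functor.map_comp, hfac]
    have hfacD : T.toD.map β ≫ T.toD.map α = T.toD.map φ := by rw [← Functor.map_comp, hfac]
    obtain ⟨hβ0, hα0⟩ := hF0 (T.toF0.map φ) hpb (T.toF0.map β) (T.toF0.map α) hfac0
    rcases hD.2.2 (T.toD.map β) (T.toD.map α) hfacD with hαD | hβD
    · exact Or.inl (hrefl α hαD (hα0 (hbase α hαD)))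
    · exact Or.inr (hrefl β hβD (hβ0 (hbase β hβD)))

end Tower

/-! ### The criterion (c) for `F₀ = A₀` -/

/-- An arrow of `A₀` whose underlying arrow of `C₀` is invertible is invertible in `A₀` (the inverse is
an isometry). [cite: MochizukiFrdII2008, Ex 3.3 (iii) p.28] -/
theorem A0.isIso_of_isIso_hom {P Q : A0} (f : P ⟶ Q) [IsIso f.hom] : IsIso f := by
  refine ⟨⟨⟨inv f.hom, C0.isIsometry_inv f.hom⟩, ?_, ?_⟩⟩
  · exact WideSubcategory.hom_ext _ (IsIso.hom_inv_id f.hom)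
  · exact WideSubcategory.hom_ext _ (IsIso.inv_hom_id f.hom)

/-- A pull-back morphism of `A₀` into a REAL object is linear: its Frobenius degree divides the degree
of the degree-one isometry "rescale onto the unit object over `Spec ℝ`, then onto the target", through
which it factors by the pull-back property. [cite: MochizukiFrdII2008, Prop 3.4 (vii) p.31] -/
theorem A0.degFr_eq_one_of_isPullbackMorphism {X₀ Y₀ : A0} (φ₀ : X₀ ⟶ Y₀)
    (hpb : PreFrobenioid.IsPullbackMorphism A0.toElem φ₀) (hY : Y₀.obj.IsRealObj) :
    C0.degFr φ₀.hom = 1 := by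
  -- the degree-one test arrow `X₀ → (unit object over Spec ℝ) → Y₀`
  have hU : (C0.unitObj Y₀.obj.base).IsRealObj := hY
  have h₁ : PreFrobenioid.isometricMorphisms C0.toElem (C0.toUnitObj X₀.obj (C0.Base φ₀.hom)) :=
    C0.isIsometry_toUnitObj X₀.obj _
  have h₂ : PreFrobenioid.isometricMorphisms C0.toElem
      (N0.realRescaleHom (C0.unitObj Y₀.obj.base) Y₀.obj hU hY) :=
    N0.isIsometry_realRescaleHom _ _ hU hY
  let χ : X₀ ⟶ Y₀ :=
    ⟨C0.toUnitObj X₀.obj (C0.Base φ₀.hom) ≫ N0.realRescaleHom (C0.unitObj Y₀.obj.base) Y₀.obj hU hY,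
      (PreFrobenioid.isometricMorphisms C0.toElem).comp_mem _ _ h₁ h₂⟩
  have hdegχ : C0.degFr χ.hom = 1 := by
    change C0.degFr (C0.toUnitObj X₀.obj (C0.Base φ₀.hom)) *
      C0.degFr (N0.realRescaleHom (C0.unitObj Y₀.obj.base) Y₀.obj hU hY) = 1
    rfl
  -- the base condition holds automatically: both sides are arrows into `Spec ℝ`
  have hsub : ∀ f g : X₀.obj.base ⟶ Y₀.obj.base, f = g := by
    rw [show Y₀.obj.base = D0.real from hY]
    exact fun f g => Subsingleton.elim f g
  have hcond : PreFrobenioid.Base A0.toElem χ = 𝟙 _ ≫ PreFrobenioid.Base A0.toElem φ₀ := hsub _ _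
  obtain ⟨ψ, hψ⟩ := (hpb X₀).2 ⟨(χ, 𝟙 _), hcond⟩
  have hψ₁ : ψ ≫ φ₀ = χ := congrArg (fun p : PreFrobenioid.PullbackHomData A0.toElem φ₀ X₀ => p.1.1) hψ
  have hdeg : C0.degFr (ψ.hom ≫ φ₀.hom) = 1 := by
    have h := congrArg (fun k : X₀ ⟶ Y₀ => C0.degFr k.hom) hψ₁
    exact h.trans hdegχ
  exact (C0.degFr_eq_one_of_comp _ _ hdeg).2

/-- **Criterion (c) for `A₀`**: for a pull-back morphism `φ₀ = β₀ ≫ α₀` of `A₀`, a factor lying over an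
isomorphism of `D₀` is an isomorphism. [cite: MochizukiFrdII2008, Prop 3.4 (vii) p.31] -/
theorem A0.isIso_factors_of_pullback {X₀ M₀ Y₀ : A0} (φ₀ : X₀ ⟶ Y₀)
    (hpb : PreFrobenioid.IsPullbackMorphism A0.toElem φ₀) (β₀ : X₀ ⟶ M₀) (α₀ : M₀ ⟶ Y₀)
    (hfac : β₀ ≫ α₀ = φ₀) :
    (IsIso (A0.toD0.map β₀) → IsIso β₀) ∧ (IsIso (A0.toD0.map α₀) → IsIso α₀) := by
  refine ⟨fun hβ => isIso_left_of_pullback_fac A0.toElem A0.isTotallyEpimorphic' hpb β₀ α₀ hfac hβ,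
    fun hα => ?_⟩
  rcases D0.isIso_or_eq (C0.Base φ₀.hom) with hφb | ⟨-, hY⟩
  · exact (isIso_and_isIso_of_pullback_fac_of_isIso_base A0.toElem A0.isTotallyEpimorphic' hpb β₀ α₀
      hfac hφb).1
  · -- `Base φ₀ : Spec ℂ → Spec ℝ`: the middle object is real and `α₀` is a linear real-real isometry
    have hM : M₀.obj.base = D0.real := D0.eq_real_of_isIso_of_eq_real (C0.Base α₀.hom) hα hY
    have hfac' : β₀.hom ≫ α₀.hom = φ₀.hom := congrArg (fun k => k.hom) hfac
    have hdeg : C0.degFr α₀.hom = 1 := by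
      have h := A0.degFr_eq_one_of_isPullbackMorphism φ₀ hpb hY
      rw [← hfac'] at h
      exact (C0.degFr_eq_one_of_comp _ _ h).2
    have hiso : ‖(C0.scalar α₀.hom : ℂ)‖ * M₀.obj.tip ^ (C0.degFr α₀.hom : ℕ) = Y₀.obj.tip :=
      (A0.isIsometry_iff_norm_mul_tip_pow α₀.hom).mp α₀.property
    haveI : IsIso (C0.Base α₀.hom) := hα
    haveI : IsIso α₀.hom :=
      C0.isIso_of_isIsotropic α₀.hom (C0.isNaivelyIsotropic_of_isRealObj hM) hdeg hiso
    exact A0.isIso_of_isIso_hom α₀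

/-! ### The criterion (c) for `F₀ = N₀` -/

/-- **Criterion (c) for `N₀`** (words read through `C₀`): for a pull-back morphism `φ₀ = β₀ ≫ α₀` of
`N₀`, a factor lying over an isomorphism of `D₀` is an isomorphism (real-real arrows of `N₀` are
isomorphisms, `N0.isIso_of_isRealObj`). [cite: MochizukiFrdII2008, Prop 3.4 (vii) p.31] -/
theorem N0.isIso_factors_of_pullback {X₀ M₀ Y₀ : N0} (φ₀ : X₀ ⟶ Y₀)
    (hpb : PreFrobenioid.IsPullbackMorphism (N0.toC0 ⋙ C0.toElem) φ₀) (β₀ : X₀ ⟶ M₀) (α₀ : M₀ ⟶ Y₀)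
    (hfac : β₀ ≫ α₀ = φ₀) :
    (IsIso (N0.toD0.map β₀) → IsIso β₀) ∧ (IsIso (N0.toD0.map α₀) → IsIso α₀) := by
  refine ⟨fun hβ => isIso_left_of_pullback_fac (N0.toC0 ⋙ C0.toElem) N0.isTotallyEpimorphic' hpb β₀ α₀
    hfac hβ, fun hα => ?_⟩
  rcases D0.isIso_or_eq (C0.Base φ₀.hom.hom) with hφb | ⟨-, hY⟩
  · exact (isIso_and_isIso_of_pullback_fac_of_isIso_base (N0.toC0 ⋙ C0.toElem)
      N0.isTotallyEpimorphic' hpb β₀ α₀ hfac hφb).1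
  · have hM : M₀.carrier.base = D0.real := D0.eq_real_of_isIso_of_eq_real (C0.Base α₀.hom.hom) hα hY
    exact N0.isIso_of_isRealObj α₀ hM hY

/-! ### The criterion (c) for `F₀ = R₀` -/

/-- **Criterion (c) for `R₀ = (N₀)_{[ℝ-unit]}`**: for a pull-back morphism `φ₀ = β₀ ≫ α₀` of `R₀`, a
factor lying over an isomorphism of `D₀` is an isomorphism. [cite: MochizukiFrdII2008, Prop 3.4 (vii) p.31] -/
theorem R0.isIso_factors_of_pullback {X₀ M₀ Y₀ : R0} (φ₀ : X₀ ⟶ Y₀)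
    (hpb : PreFrobenioid.IsPullbackMorphism (R0.toC0 ⋙ C0.toElem) φ₀) (β₀ : X₀ ⟶ M₀) (α₀ : M₀ ⟶ Y₀)
    (hfac : β₀ ≫ α₀ = φ₀) :
    (IsIso (R0.toD0.map β₀) → IsIso β₀) ∧ (IsIso (R0.toD0.map α₀) → IsIso α₀) := by
  refine ⟨fun hβ => isIso_left_of_pullback_fac (R0.toC0 ⋙ C0.toElem) R0.isTotallyEpimorphic' hpb β₀ α₀
    hfac hβ, fun hα => ?_⟩
  rcases D0.isIso_or_eq (C0.Base φ₀.left.hom.hom) with hφb | ⟨-, hY⟩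
  · exact (isIso_and_isIso_of_pullback_fac_of_isIso_base (R0.toC0 ⋙ C0.toElem)
      R0.isTotallyEpimorphic' hpb β₀ α₀ hfac hφb).1
  · have hM : M₀.left.carrier.base = D0.real :=
      D0.eq_real_of_isIso_of_eq_real (C0.Base α₀.left.hom.hom) hα hY
    haveI : IsIso α₀.left := N0.isIso_of_isRealObj α₀.left hM hY
    haveI : IsIso ((Over.forget N0.realUnit).map α₀) := by
      change IsIso α₀.left; infer_instance
    exact isIso_of_reflects_iso α₀ (Over.forget N0.realUnit)

/-! ### Proposition 3.4 (vii) for `F = A, N, R` -/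

variable {D : Type u} [Category.{v} D] (π : D ⥤ D0)

/-- **Proposition 3.4 (vii) for `F = A`**, as typed (FSM half: abc-iut-L1-d3's `A.isFSM_of_pullback`;
FSMI half: the generic `Tower.isFSMI_of_pullback`). [cite: MochizukiFrdII2008, Prop 3.4 (vii) p.30] -/
theorem A.propVII : (towerA π).PropVII := fun _ _ φ hpb =>
  ⟨fun hD => A.isFSM_of_pullback π φ hpb hD, fun hD =>
    (towerA π).isFSMI_of_pullback (fun _ _ ψ h1 h2 => A.isIso_of_isIso_proj π ψ h1 h2)
      (fun _ _ ψ => A.isIso_base0_of_isIso_toD π ψ)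
      (fun _ _ _ φ₀ h β₀ α₀ hf => A0.isIso_factors_of_pullback φ₀ h β₀ α₀ hf)
      φ hpb (A.isFSM_of_pullback π φ hpb hD.1) hD⟩

/-- **Proposition 3.4 (vii) for `F = N`**, as typed. [cite: MochizukiFrdII2008, Prop 3.4 (vii) p.30] -/
theorem N.propVII : (towerN π).PropVII := fun _ _ φ hpb =>
  ⟨fun hD => N.isFSM_of_pullback π φ hpb hD, fun hD =>
    (towerN π).isFSMI_of_pullback (fun _ _ ψ h1 h2 => N.isIso_of_isIso_proj π ψ h1 h2)
      (fun _ _ ψ => N.isIso_base0_of_isIso_toD π ψ)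
      (fun _ _ _ φ₀ h β₀ α₀ hf => N0.isIso_factors_of_pullback φ₀ h β₀ α₀ hf)
      φ hpb (N.isFSM_of_pullback π φ hpb hD.1) hD⟩

/-- **Proposition 3.4 (vii) for `F = R`**, as typed. [cite: MochizukiFrdII2008, Prop 3.4 (vii) p.30] -/
theorem R.propVII : (towerR π).PropVII := fun _ _ φ hpb =>
  ⟨fun hD => R.isFSM_of_pullback π φ hpb hD, fun hD =>
    (towerR π).isFSMI_of_pullback (fun _ _ ψ h1 h2 => R.isIso_of_isIso_proj π ψ h1 h2)
      (fun _ _ ψ => R.isIso_base0_of_isIso_toD π ψ)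
      (fun _ _ _ φ₀ h β₀ α₀ hf => R0.isIso_factors_of_pullback φ₀ h β₀ α₀ hf)
      φ hpb (R.isFSM_of_pullback π φ hpb hD.1) hD⟩

/-- **Proposition 3.4 (vii)** PROVED AS TYPED, for `F = A, N, R` (FrdII p. 30): an arrow of `F`
projecting to a pull-back morphism of `F₀` and to an FSM-morphism (resp. FSMI-morphism) of `D` is an
FSM-morphism (resp. FSMI-morphism) of `F` — node `FrdII:Prop3.4(vii)`, sub-node `P34-L08`
(`PullbackOverFSMIsFSM`) of the cell's SUBDAG-FrdII-Prop34; FSM half by abc-iut-L1-d3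
(`prop34_vii_fsm`), FSMI half here. [cite: MochizukiFrdII2008, Prop 3.4 (vii) p.30] -/
theorem prop34_vii_holds : Prop34_vii π :=
  ⟨A.propVII π, N.propVII π, R.propVII π⟩

/-- `Prop34_vii` — `_holds` alias of `prop34_vii_holds` above under the fact's exact name (appended
2026-08-28, D-0026 bookkeeping: the proof term is the existing theorem of this file; no statement,
definition or attribute is edited; no new named fact; the ledger's debt table listed the fact
unproved). [cite: MochizukiFrdII2008, Prop 3.4 (vii) p.30] -/
theorem _root_.Literature.AlgebraicGeometry.Frobenioids.ArchFrd.Prop34_vii_holds : Prop34_vii π :=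
  _root_.Literature.AlgebraicGeometry.Frobenioids.ArchFrd.prop34_vii_holds (π := π)

end ArchFrd

end Literature.AlgebraicGeometry.Frobenioids
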